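import Mathlib

/-!
# Route `JensenPolynomials`, FAR crux `XiWindowZeroFreeRelFar` (B1-rel far) — S3 step 5: the numeric BUDGET of the master
assembly (RH-FREE; cell rh-jensen, HUMAN RULING D-0040)

`FarGumbel.laplaceFar_of_pointwise` (item `stmt-RiemannHypothesis-19465`, stub S3) needs one real inequality «total error ≤ θ·|main
term|». With the certified constants of the S3 WANTED list (window `δ = 1/25`, `M_c = 30Λ` from `‖Ψ‴‖ ≤ 180Λ`, `Re c ≥ 5.5Λ`,
`Re c ≤ ‖c‖ ≤ 13Λ`, drift `‖b‖ ≤ 6`, amplitude `η ≤ 1/474`, descent `A = Λ/500`, connector `e^{−Λ}`, `Re(b²/4c) ≥ −1`) and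
`Λ ≥ 9·10⁶` it holds with `θ = 1/4` (`budget_quarter`): every error term is `O(Λ^{−1})` or exponentially small while the main term is
`≍ Λ^{−1/2}`. Pure real arithmetic (`e^{−y} ≤ 1/y`, `e^{−y} ≤ 2/y²` as local steps, `e ≤ 3`, `√`-monotonicity); no `ξ`, no `Φ`.
WHAT THIS IS NOT: bookkeeping; nothing here bears on the zeros of `ζ` or the truth of RH.
-/

noncomputable section
-- D-0017: `Summit.RiemannHypothesis.RiemannHypothesis.…` duplicates the namespace BY DESIGN (single-problem summit).
set_option linter.dupNamespace false

namespace Summit.RiemannHypothesis.RiemannHypothesis.Theorems.JensenPolynomials.FarGumbel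

open scoped Real

/-- `√(2π/R) ≤ (11/10)/q` when `q² = Λ`, `q > 0` and `R ≥ (11/2)Λ`. -/
theorem sqrt_two_pi_div_le {Λ q R : ℝ} (hq : q ^ 2 = Λ) (hq0 : 0 < q) (hR : 11 / 2 * Λ ≤ R) :
    Real.sqrt (2 * π / R) ≤ 11 / 10 / q := by
  have hΛ : 0 < Λ := by rw [← hq]; positivity
  have hRpos : 0 < R := by linarith
  have hπ : π < 3.15 := Real.pi_lt_d2
  rw [Real.sqrt_le_left (by positivity)]
  rw [div_le_iff₀ hRpos]
  have : (11 / 10 / q) ^ 2 * R = (121 / 100) * R / Λ := by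
    rw [← hq]; field_simp; ring
  rw [this, le_div_iff₀ hΛ]
  nlinarith

/-- `(49/100)/q ≤ (π/n)^{1/2}` when `q² = Λ`, `q > 0`, `0 < n ≤ 13Λ`. -/
theorem le_rpow_half_pi_div {Λ q n : ℝ} (hq : q ^ 2 = Λ) (hq0 : 0 < q) (hn0 : 0 < n) (hn : n ≤ 13 * Λ) :
    49 / 100 / q ≤ (π / n) ^ (1 / 2 : ℝ) := by
  have hπ : 3.14 < π := Real.pi_gt_d2
  rw [← Real.sqrt_eq_rpow]
  apply Real.le_sqrt_of_sq_le
  rw [le_div_iff₀ hn0]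
  have : (49 / 100 / q) ^ 2 * n = (2401 / 10000) * n / Λ := by rw [← hq]; field_simp; ring
  rw [this, div_le_iff₀ (by rw [← hq]; positivity)]
  nlinarith

/-- **The budget with `θ = 1/4`.** Hypotheses: `q² = Λ`, `q ≥ 3000` (`Λ ≥ 9·10⁶`), `E > 0` (= `e^{Re Ψ(u_s)}`),
`(11/2)Λ ≤ R ≤ n ≤ 13Λ` (`R = Re c`, `n = ‖c‖`), `0 ≤ β ≤ 6` (= `‖b‖`), `0 ≤ η ≤ 1/474`, `1 ≤ ℓ ≤ 16/5`
(= `x_s − δ − (υ−2) + 1`), `|y| ≤ 1/10` (= `y_s`), `ρ ≥ −1` (= `Re(b²/4c)`). Conclusion: the `hbudget` hypothesis of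
`laplaceFar_of_pointwise` with `M_c = 30Λ`, `δ = 1/25`, `A = Λ/500`, `E_conn = E·e^{−Λ}|y|`, `θ = 1/4`. -/
theorem budget_quarter {Λ q E R n β η ℓ y ρ : ℝ} (hq : q ^ 2 = Λ) (hq0 : 3000 ≤ q) (hE : 0 < E)
    (hR : 11 / 2 * Λ ≤ R) (hRn : R ≤ n) (hn : n ≤ 13 * Λ) (hβ0 : 0 ≤ β) (hβ : β ≤ 6) (hη0 : 0 ≤ η) (hη : η ≤ 1 / 474)
    (hℓ0 : 1 ≤ ℓ) (hℓ : ℓ ≤ 16 / 5) (hy : |y| ≤ 1 / 10) (hρ : -1 ≤ ρ) :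
    E * (Real.exp (β ^ 2 / R) * (4 * (30 * Λ) / R ^ 2 + Real.exp (-(R * (1 / 25) ^ 2 / 4)) * Real.sqrt (2 * π / R) +
        η * Real.sqrt (2 * π / R)) + (1 + η) * Real.exp (-(Λ / 500)) * ℓ) + Real.exp (Real.log E - Λ) * |y| ≤
      1 / 4 * (Real.exp (Real.log E + ρ) * (π / n) ^ (1 / 2 : ℝ)) := by
  have hqpos : 0 < q := by linarith
  have hΛ : Λ = q ^ 2 := hq.symm
  have hΛpos : 0 < Λ := by rw [hΛ]; positivity
  have hΛ9 : 9000000 ≤ Λ := by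
    have : (3000 : ℝ) ^ 2 ≤ q ^ 2 := pow_le_pow_left₀ (by norm_num) hq0 2
    rw [hΛ]; linarith
  have hRpos : 0 < R := by linarith
  have hnpos : 0 < n := by linarith
  -- two elementary exponential bounds (also in the tree as `Literature…Tao2016.exp_neg_le_inv` /
  -- `Literature…Automorphic.exp_neg_le_two_div_sq`; restated locally to keep the imports light)
  have exp_neg_le_inv : ∀ {y : ℝ}, 0 < y → Real.exp (-y) ≤ 1 / y := by
    intro y hy
    have h1 : 1 + y ≤ Real.exp y := by linarith [Real.add_one_le_exp y]
    rw [Real.exp_neg, inv_eq_one_div]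
    exact one_div_le_one_div_of_le hy (by linarith)
  have exp_neg_le_two_div_sq : ∀ {y : ℝ}, 0 < y → Real.exp (-y) ≤ 2 / y ^ 2 := by
    intro y hy
    have h1 : 1 + y + y ^ 2 / 2 ≤ Real.exp y := Real.quadratic_le_exp_of_nonneg hy.le
    have h2 : y ^ 2 / 2 ≤ Real.exp y := by nlinarith
    rw [Real.exp_neg, inv_eq_one_div, div_le_div_iff₀ (Real.exp_pos y) (by positivity)]
    nlinarith
  -- transcendental pieces, one by one
  have h1 : Real.exp (β ^ 2 / R) ≤ 3 := by
    have hx : β ^ 2 / R ≤ 1 := by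
      rw [div_le_one hRpos]; nlinarith
    calc Real.exp (β ^ 2 / R) ≤ Real.exp 1 := Real.exp_monotone hx
      _ ≤ 3 := Real.exp_one_lt_d9.le.trans (by norm_num)
  have h2 : 4 * (30 * Λ) / R ^ 2 ≤ 4 / Λ := by
    have hRR : (11 / 2 * Λ) * (11 / 2 * Λ) ≤ R * R := mul_le_mul hR hR (by positivity) (by positivity)
    rw [div_le_div_iff₀ (by positivity) hΛpos]
    nlinarith [hRR, hΛpos]
  have h3 : Real.sqrt (2 * π / R) ≤ 11 / 10 / q := sqrt_two_pi_div_le hq hqpos hR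
  have h4 : Real.exp (-(R * (1 / 25) ^ 2 / 4)) ≤ 2500 / R := by
    have := exp_neg_le_inv (y := R * (1 / 25) ^ 2 / 4) (by positivity)
    calc Real.exp (-(R * (1 / 25) ^ 2 / 4)) ≤ 1 / (R * (1 / 25) ^ 2 / 4) := this
      _ = 2500 / R := by field_simp; ring
  have h5 : Real.exp (-(Λ / 500)) ≤ 2 / (Λ / 500) ^ 2 := exp_neg_le_two_div_sq (by positivity)
  have h6 : Real.exp (Real.log E - Λ) * |y| ≤ E * (1 / Λ) * (1 / 10) := by
    rw [Real.exp_sub, Real.exp_log hE]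
    have : E / Real.exp Λ = E * Real.exp (-Λ) := by rw [Real.exp_neg]; ring
    rw [this]
    have hyn : 0 ≤ |y| := abs_nonneg y
    have := exp_neg_le_inv hΛpos
    calc E * Real.exp (-Λ) * |y| ≤ E * (1 / Λ) * |y| := by gcongr
      _ ≤ E * (1 / Λ) * (1 / 10) := by gcongr
  have h7 : 49 / 100 / q ≤ (π / n) ^ (1 / 2 : ℝ) := le_rpow_half_pi_div hq hqpos hnpos hn
  have h8 : E * (1 / 3) ≤ Real.exp (Real.log E + ρ) := by
    rw [Real.exp_add, Real.exp_log hE]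
    have : (1 : ℝ) / 3 ≤ Real.exp ρ := by
      calc (1 : ℝ) / 3 ≤ Real.exp (-1) := by
            rw [Real.exp_neg, inv_eq_one_div]
            exact one_div_le_one_div_of_le (Real.exp_pos 1) (Real.exp_one_lt_d9.le.trans (by norm_num))
        _ ≤ Real.exp ρ := Real.exp_monotone hρ
    exact mul_le_mul_of_nonneg_left this hE.le
  -- put the pieces together: LHS ≤ E·(stuff in 1/q, 1/Λ) and RHS ≥ E·(49/1200)/q
  have hsq : 0 ≤ Real.sqrt (2 * π / R) := Real.sqrt_nonneg _
  have hexp1 : 0 ≤ Real.exp (β ^ 2 / R) := (Real.exp_pos _).le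
  have hA : Real.exp (β ^ 2 / R) * (4 * (30 * Λ) / R ^ 2 + Real.exp (-(R * (1 / 25) ^ 2 / 4)) * Real.sqrt (2 * π / R) +
        η * Real.sqrt (2 * π / R)) ≤ 3 * (4 / Λ + (2500 / R) * (11 / 10 / q) + η * (11 / 10 / q)) := by
    have hin : 4 * (30 * Λ) / R ^ 2 + Real.exp (-(R * (1 / 25) ^ 2 / 4)) * Real.sqrt (2 * π / R) +
        η * Real.sqrt (2 * π / R) ≤ 4 / Λ + (2500 / R) * (11 / 10 / q) + η * (11 / 10 / q) := by
      have t2 : Real.exp (-(R * (1 / 25) ^ 2 / 4)) * Real.sqrt (2 * π / R) ≤ (2500 / R) * (11 / 10 / q) :=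
        mul_le_mul h4 h3 hsq (by positivity)
      have t3 : η * Real.sqrt (2 * π / R) ≤ η * (11 / 10 / q) := mul_le_mul_of_nonneg_left h3 hη0
      linarith
    have hin0 : 0 ≤ 4 * (30 * Λ) / R ^ 2 + Real.exp (-(R * (1 / 25) ^ 2 / 4)) * Real.sqrt (2 * π / R) +
        η * Real.sqrt (2 * π / R) := by positivity
    calc _ ≤ 3 * (4 * (30 * Λ) / R ^ 2 + Real.exp (-(R * (1 / 25) ^ 2 / 4)) * Real.sqrt (2 * π / R) +
          η * Real.sqrt (2 * π / R)) := mul_le_mul_of_nonneg_right h1 hin0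
      _ ≤ _ := by gcongr
  have hB : (1 + η) * Real.exp (-(Λ / 500)) * ℓ ≤ 2 * (2 / (Λ / 500) ^ 2) * (16 / 5) := by
    have : (1 + η) ≤ 2 := by linarith
    have hℓ' : 0 ≤ ℓ := by linarith
    calc (1 + η) * Real.exp (-(Λ / 500)) * ℓ ≤ 2 * (2 / (Λ / 500) ^ 2) * ℓ := by gcongr
      _ ≤ 2 * (2 / (Λ / 500) ^ 2) * (16 / 5) := by gcongr
  -- reduce to an inequality in `q` alone
  have hR' : 2500 / R ≤ 2500 / (11 / 2 * Λ) := div_le_div_of_nonneg_left (by norm_num) (by positivity) hR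
  have key : 3 * (4 / Λ + (2500 / (11 / 2 * Λ)) * (11 / 10 / q) + (1 / 474) * (11 / 10 / q)) +
      2 * (2 / (Λ / 500) ^ 2) * (16 / 5) + (1 / Λ) * (1 / 10) ≤ 1 / 4 * ((1 / 3) * (49 / 100 / q)) := by
    -- substitute `t = 1/q ∈ (0, 1/3000]`
    have ht0 : 0 < 1 / q := by positivity
    have ht : 1 / q ≤ 1 / 3000 := one_div_le_one_div_of_le (by norm_num) hq0
    have e1 : 4 / Λ = 4 * (1 / q) ^ 2 := by rw [hΛ]; field_simp
    have e2 : 2500 / (11 / 2 * Λ) = 5000 / 11 * (1 / q) ^ 2 := by rw [hΛ]; field_simp; ring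
    have e3 : (11 : ℝ) / 10 / q = 11 / 10 * (1 / q) := by field_simp
    have e4 : 2 / (Λ / 500) ^ 2 = 500000 * (1 / q) ^ 4 := by rw [hΛ]; field_simp; ring
    have e5 : 1 / Λ = (1 / q) ^ 2 := by rw [hΛ]; field_simp
    have e6 : (49 : ℝ) / 100 / q = 49 / 100 * (1 / q) := by field_simp
    rw [e1, e2, e3, e4, e5, e6]
    set t : ℝ := 1 / q with htdef
    have ht2 : t ^ 2 ≤ t / 3000 := by
      calc t ^ 2 = t * t := by ring
        _ ≤ t * (1 / 3000) := by gcongr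
        _ = t / 3000 := by ring
    have ht3 : t ^ 3 ≤ t / 9000000 := by
      calc t ^ 3 = t * t ^ 2 := by ring
        _ ≤ t * (t / 3000) := by gcongr
        _ = t ^ 2 / 3000 := by ring
        _ ≤ (t / 3000) / 3000 := by gcongr
        _ = t / 9000000 := by ring
    have ht4 : t ^ 4 = t * t ^ 3 := by ring
    have ht4' : t ^ 4 ≤ t / 27000000000 := by
      calc t ^ 4 = t * t ^ 3 := by ring
        _ ≤ t * (t / 9000000) := by gcongr
        _ = t ^ 2 / 9000000 := by ring
        _ ≤ (t / 3000) / 9000000 := by gcongr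
        _ = t / 27000000000 := by ring
    have hgoal : 3 * (4 * t ^ 2 + 5000 / 11 * t ^ 2 * (11 / 10 * t) + 1 / 474 * (11 / 10 * t)) +
        2 * (500000 * t ^ 4) * (16 / 5) + t ^ 2 * (1 / 10) ≤ 1 / 4 * (1 / 3 * (49 / 100 * t)) := by
      have e : 5000 / 11 * t ^ 2 * (11 / 10 * t) = 500 * t ^ 3 := by ring
      rw [e]
      linarith
    exact hgoal
  have hmid : 3 * (4 / Λ + (2500 / R) * (11 / 10 / q) + η * (11 / 10 / q)) + 2 * (2 / (Λ / 500) ^ 2) * (16 / 5) +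
      (1 / Λ) * (1 / 10) ≤ 1 / 4 * ((1 / 3) * (49 / 100 / q)) := by
    have e1 : (2500 / R) * (11 / 10 / q) ≤ (2500 / (11 / 2 * Λ)) * (11 / 10 / q) :=
      mul_le_mul_of_nonneg_right hR' (by positivity)
    have e2 : η * (11 / 10 / q) ≤ (1 / 474) * (11 / 10 / q) := mul_le_mul_of_nonneg_right hη (by positivity)
    linarith
  calc E * (Real.exp (β ^ 2 / R) * (4 * (30 * Λ) / R ^ 2 + Real.exp (-(R * (1 / 25) ^ 2 / 4)) * Real.sqrt (2 * π / R) +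
          η * Real.sqrt (2 * π / R)) + (1 + η) * Real.exp (-(Λ / 500)) * ℓ) + Real.exp (Real.log E - Λ) * |y|
      ≤ E * (3 * (4 / Λ + (2500 / R) * (11 / 10 / q) + η * (11 / 10 / q)) + 2 * (2 / (Λ / 500) ^ 2) * (16 / 5)) +
          E * (1 / Λ) * (1 / 10) := by
        gcongr
    _ = E * (3 * (4 / Λ + (2500 / R) * (11 / 10 / q) + η * (11 / 10 / q)) + 2 * (2 / (Λ / 500) ^ 2) * (16 / 5) +
          (1 / Λ) * (1 / 10)) := by ring
    _ ≤ E * (1 / 4 * ((1 / 3) * (49 / 100 / q))) := mul_le_mul_of_nonneg_left hmid hE.le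
    _ = 1 / 4 * ((E * (1 / 3)) * (49 / 100 / q)) := by ring
    _ ≤ 1 / 4 * (Real.exp (Real.log E + ρ) * (π / n) ^ (1 / 2 : ℝ)) := by
        gcongr

end Summit.RiemannHypothesis.RiemannHypothesis.Theorems.JensenPolynomials.FarGumbel

end
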